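import Summits.BirchSwinnertonDyer.BirchSwinnertonDyer.Theorems.ErratumRoadFiveOpenInputNotRamBDPFrameDescentStub
import Literature.NumberTheory.EllipticCurves.Castella2024.BDPLFunctionExistenceMultiplicative
import Literature.NumberTheory.EllipticCurves.StrictSelmerRankOneDegreeOneProofs
import HarnessLib

/-!
# Route `ErratumRoadFive`, crux `EulerHalfNotRamNoInertSetAtFive` (item stmt-BirchSwinnertonDyer-19715) — the
# by-citation frame fact `Castella2024.exists_isBDPLFunction_multiplicative` (p774890) CERTIFIED from two REFEREED
# named facts of the tree, by the cell's own `R₀`-descent at `p ∥ N`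

Cell `bsd-stepL` (HOME `run/shared/lean/pub/bsd-stepL/`), ideator seat `bsd-idea-9` (g45, lens = complete),
`--supports stmt-BirchSwinnertonDyer-19715` (a HELPER; closes no item, no registered stub, no crux).

WHAT THIS FILE DOES. The Literature module `Castella2024/BDPLFunctionExistenceMultiplicative.lean` (p774890, typed by
this seat) records, as ONE named fact flagged `C23-cite` (frame BY CITATION), Castella 2024 §2.3's assertion that the
Bertolini–Darmon–Prasanna anticyclotomic `p`-adic `L`-function admits the `R₀`-frame `(Ω_K ≠ 0, Ω_p ∈ R₀ˣ,
L_𝔭(f) ∈ R₀⟦T⟧)` with the tree's interpolation predicate `IsBDPLFunction` at a MULTIPLICATIVE prime `p ≥ 5` of a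
curve of ANY conductor (A206 `castella2018_exists_isBDPLFunction` with `Squarefree N` replaced by Castella 2024 §2.1's
standing hypotheses). THIS FILE PROVES THAT FACT from two REFEREED named facts already in the tree —

* (H14) `hsieh2014_exists_anticyclotomicPAdicLFunction_unrPeriod` — Hsieh, Doc. Math. 19 (2014), Thm. A = Thm. 5.6/5.7
  with the Katz–Hida–Tilouine period `Ω_p ∈ 𝒲^×` (`AnticyclotomicRankinSelbergPAdicLFunction.lean`; `p` odd, `p² ∤ N`,
  i.e. `p ∥ N` ALLOWED — Hsieh's level datum is the prime-to-`p` conductor, no hypothesis on `π_p`), and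
* (R) `bertoliniDarmonPrasanna2013_centralValue_reciprocity` — Bertolini–Darmon–Prasanna, Duke Math. J. 162 (2013),
  Thm. 5.5 with its proof ((5.1.16), Prop. 1.12 (1) = Shimura, Lemma 5.3) (`BDPCentralValueReciprocity.lean`; a
  statement about complex central values, no `p` at all) —

through the cell's general-`p` `R₀`-DESCENT `exists_isBDPLFunction_of_hsieh2014_unrPeriod_of_bdp2013`
(`Theorems/ErratumRoadFiveOpenInputNotRamBDPFrameDescentStub.lean`, seat `bsd-stepL-nram2` g2, 2026-08-26: the
`R₀`-frame is DESCENDED from Hsieh's `𝒪_{ℂ_p}`-frame using `Ω_p ∈ 𝒲^×` and BDP13's reciprocity — finite Galois orbits,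
no Tate–Sen), plus three lines of plumbing: `p ∣ N` and `p² ∤ N` from multiplicative reduction
(`X11b.dvd_conductorNorm_of_mult`, `X11b.not_sq_dvd_conductorNorm_of_mult`), `p` split from the all-split Heegner
hypothesis at `ℓ = p`, and `e(𝔭|p) = f(𝔭|p) = 1` from `p` split in the quadratic `K`
(`ramificationIdx_eq_one_and_inertiaDeg_eq_one_of_ncard_primesOver_eq_two`). The binders `5 ≤ p` (only `p ≠ 2` is
used), `ρ̄_{E,p}` irreducible and `d_K < −4` of the fact are IDLE.

CONSEQUENCE FOR THE RECORD (a CORRECTION of this seat's own door docstrings, revs 3.5–3.8 of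
`Cruxes/EulerHalfNotRamNoInertSetAtFive/BstwZetaNonsplitDoorSketch.lean`, and of the card
`Ideas/bstw-zeta-nonsplit-door.md` revs 1.9–1.12, which called the frame at `p ∥ N` for non-square-free `N` «NOT a
tree fact today … in print BY CITATION only»): the frame WAS derivable in the tree since 2026-08-26 from (H14) + (R) by
the nram2 descent (landed for crux `OpenInputNotRam`, item 19282, on the same `¬Ram` class); the by-citation flag
`C23-cite` of p774890 is therefore DISCHARGED CONDITIONALLY on two refereed facts (this file), and the door's A♯-print
stub is a theorem of (H14) ∧ (R) (door rev 3.9 consumes exactly that). Net: the door's entire non-research content rests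
on REFEREED print held by name; Castella 2024's sentence is no longer load-bearing anywhere on this crux.

HONEST FRAMING: CONDITIONAL theorems (hypotheses = the two refereed named facts, carried BY NAME, not discharged in
the tree); no definition, no new named fact, no `sorry`, no instance, no notation; nothing about crux 19715, its
registered stubs (`Lines/kato_Fframe_r5.lean` r5.6), route `ErratumRoadFive` or any case of BSD is proved or claimed.

References: [Hsieh2014] Thm. A (p. 712) = Thm. 5.6/5.7 (arXiv:1112.1580 pp. 3–4, 23); [BertoliniDarmonPrasanna2013]
Thm. 5.5, (5.1.16) (p. 60), Prop. 1.12 (1), Lemma 5.3; [Castella2018] Thm. 3.1 (arXiv:1704.06608 p. 9: the display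
`IsBDPLFunction`); [Castella2024] §2.1, §2.3 (arXiv:2409.01360 l.358–370, l.465–469); [CasselsFrohlich1967] Ch. I §10
Prop. 1 (`Σ e f = n`).
-/

noncomputable section

set_option linter.dupNamespace false

open scoped Classical NumberField

open NumberField IsDedekindDomain Field WeierstrassCurve
open Literature.NumberTheory.GaloisRepresentations Literature.NumberTheory.EllipticCurves
open Literature.NumberTheory.EllipticCurves.ModularForms Literature.NumberTheory.EllipticCurves.Rank1Residual
open Summit.BirchSwinnertonDyer.Rank1Residual Summit.BirchSwinnertonDyer.Rank1Residual.X11b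
open Summit.BirchSwinnertonDyer.Rank1Residual.X11b.Three

namespace Summit.BirchSwinnertonDyer.BirchSwinnertonDyer.Theorems.BDPFramePrintMultiplicative

/-- **Plumbing: at a prime `p` of multiplicative reduction of `W` (conductor `N`) with every `ℓ ∣ N` split in the
imaginary quadratic `K`, one has `p ∣ N`, `p² ∤ N`, and every prime `𝔭 ∋ p` of `K` has `e(𝔭|p) = f(𝔭|p) = 1`.**
(`f_p(E) = 1` at a multiplicative prime; fundamental identity `Σ e f = 2` with two primes above `p`.)
[cite: Silverman1994, IV.10.2 (a)] [cite: CasselsFrohlich1967, Ch. I §10, Prop. 1] -/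
theorem dvd_and_not_sq_dvd_and_degree_one_of_mult_of_heegner {p : ℕ} [Fact p.Prime]
    (W : WeierstrassCurve ℚ) [W.IsElliptic] (K : Type) [Field K] [NumberField K]
    (𝔭 : HeightOneSpectrum (𝓞 K)) {N : ℕ} (hN : W.conductorNorm ℤ = N)
    (hmult : W.HasMultiplicativeReductionAtPrime p) (hK : IsImaginaryQuadratic K)
    (hHeeg : SatisfiesHeegnerHypothesis N K) (hp𝔭 : ((p : ℕ) : 𝓞 K) ∈ 𝔭.asIdeal) :
    p ∣ N ∧ ¬ p ^ 2 ∣ N ∧ 𝔭.asIdeal.ramificationIdx (𝓞 ℚ) = 1 ∧ 𝔭.asIdeal.inertiaDeg (𝓞 ℚ) = 1 := by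
  have hp : p.Prime := Fact.out
  have hpN : p ∣ N := hN ▸ dvd_conductorNorm_of_mult hmult
  have hp2N : ¬ p ^ 2 ∣ N := hN ▸ not_sq_dvd_conductorNorm_of_mult W p hmult
  obtain ⟨hram, hdeg⟩ :=
    ramificationIdx_eq_one_and_inertiaDeg_eq_one_of_ncard_primesOver_eq_two p hK.1 (hHeeg p hp hpN) 𝔭 hp𝔭
  exact ⟨hpN, hp2N, hram, hdeg⟩

/-- **The by-citation fact `Castella2024.exists_isBDPLFunction_multiplicative` (p774890; Castella 2024 §2.3 «`L_𝔭(f) ∈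
Λ_{R₀}` … as extended in [hsieh, cas-split] to the `p`-multiplicative case») IS A THEOREM of two REFEREED named facts
of the tree:** (H14) `hsieh2014_exists_anticyclotomicPAdicLFunction_unrPeriod` (Hsieh 2014 Thm. A = Thm. 5.6/5.7 with
`Ω_p ∈ 𝒲^×`; `p` odd, `p² ∤ N`) and (R) `bertoliniDarmonPrasanna2013_centralValue_reciprocity` (BDP13 Thm. 5.5 with its
proof), via the cell's `R₀`-descent `exists_isBDPLFunction_of_hsieh2014_unrPeriod_of_bdp2013` (nram2 g2) and the plumbing
above (`p ∣ N`, `p² ∤ N` from multiplicative reduction; `p` split from the all-split Heegner hypothesis; `e = f = 1`).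
The fact's binders `5 ≤ p` (only `p ≠ 2` is used), `ρ̄_{E,p}` irreducible and `d_K < −4` are idle. CONDITIONAL on
(H14), (R); discharges the flag `C23-cite` of p774890 conditionally on refereed print; proves nothing about crux 19715.
[cite: Hsieh2014, Thm. A (p. 712) and Thm. 5.6 (arXiv:1112.1580 pp. 3–4, 23)]
[cite: BertoliniDarmonPrasanna2013, Thm. 5.5 and (5.1.16) (p. 60)] [cite: Castella2018, Thm. 3.1 (arXiv:1704.06608 p. 9)]
[cite: Castella2024, §2.1 and §2.3 (arXiv:2409.01360 l.358–370, l.465–469)] -/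
theorem castella2024_exists_isBDPLFunction_multiplicative_of_hsieh2014_of_bdp2013
    (hH : hsieh2014_exists_anticyclotomicPAdicLFunction_unrPeriod)
    (hR : bertoliniDarmonPrasanna2013_centralValue_reciprocity) :
    Castella2024.exists_isBDPLFunction_multiplicative := by
  intro p _ ι W _ K _ _ 𝔭 κ γ N _ f hf h5 hN hmult _hirr hK hodd _hd4 hHeeg hp𝔭 hι hκ hγ
  have hp2 : p ≠ 2 := by omega
  obtain ⟨hpN, hp2N, hram, hdeg⟩ :=
    dvd_and_not_sq_dvd_and_degree_one_of_mult_of_heegner W K 𝔭 hN hmult hK hHeeg hp𝔭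
  exact exists_isBDPLFunction_of_hsieh2014_unrPeriod_of_bdp2013 hH hR hp2 ι W K 𝔭 κ γ hf hN hpN hp2N hK hodd
    hHeeg hp𝔭 hram hdeg hι hκ hγ

/-- **The same, WITHOUT the idle binders and in the binder shape of the descent** — the `R₀`-frame of `(f, K, p)` at a
MULTIPLICATIVE `p ≠ 2` for ANY conductor, all-split Heegner field of odd discriminant, `𝔭 ∋ p` compatible with `ι`
(degree one is DERIVED, not assumed): (H14) ∧ (R) ⟹ `∃ Ω_K ≠ 0, Ω_p ∈ R₀ˣ, L ∈ R₀⟦T⟧, IsBDPLFunction ι 𝔭 κ γ f Ω_K Ω_p L`.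
For by-name use by the door of crux 19715 (`Cruxes/EulerHalfNotRamNoInertSetAtFive/BstwZetaNonsplitDoorSketch.lean`,
rev 3.9) and by any X11b ∕ O2 consumer at a non-semistable member. CONDITIONAL on (H14), (R).
[cite: Hsieh2014, Thm. A (p. 712)] [cite: BertoliniDarmonPrasanna2013, Thm. 5.5 (p. 60)]
[cite: Castella2018, Thm. 3.1 (arXiv:1704.06608 p. 9)] -/
theorem exists_isBDPLFunction_of_mult_of_heegner_of_hsieh2014_of_bdp2013
    (hH : hsieh2014_exists_anticyclotomicPAdicLFunction_unrPeriod)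
    (hR : bertoliniDarmonPrasanna2013_centralValue_reciprocity)
    {p : ℕ} [Fact p.Prime] (hp2 : p ≠ 2) (ι : PadicAlgCl p ≃+* ℂ) (W : WeierstrassCurve ℚ) [W.IsElliptic]
    (K : Type) [Field K] [NumberField K] (𝔭 : HeightOneSpectrum (𝓞 K)) (κ : ZpExtension K p)
    (γ : absoluteGaloisGroup K) {N : ℕ} [NeZero N] {f : CuspForm (CongruenceSubgroup.Gamma0 N) 2}
    (hf : IsNewformOf W f) (hN : W.conductorNorm ℤ = N) (hmult : W.HasMultiplicativeReductionAtPrime p)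
    (hK : IsImaginaryQuadratic K) (hodd : Odd (NumberField.discr K)) (hHeeg : SatisfiesHeegnerHypothesis N K)
    (hp𝔭 : ((p : ℕ) : 𝓞 K) ∈ 𝔭.asIdeal)
    (hι : ∀ (w : InfinitePlace K) (k : 𝓞 K), k ∈ 𝔭.asIdeal ↔ ‖ι.symm (w.embedding (k : K))‖ < 1)
    (hκ : κ.IsAnticyclotomic) (hγ : κ.IsTopGenerator γ) :
    ∃ (ΩK : ℂ) (Ωp : (unrIntegers p)ˣ) (L : UnrSeries p),
      ΩK ≠ 0 ∧ IsBDPLFunction ι 𝔭 κ γ f ΩK ((Ωp : unrIntegers p) : ℂ_[p]) L := by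
  obtain ⟨hpN, hp2N, hram, hdeg⟩ :=
    dvd_and_not_sq_dvd_and_degree_one_of_mult_of_heegner W K 𝔭 hN hmult hK hHeeg hp𝔭
  exact exists_isBDPLFunction_of_hsieh2014_unrPeriod_of_bdp2013 hH hR hp2 ι W K 𝔭 κ γ hf hN hpN hp2N hK hodd
    hHeeg hp𝔭 hram hdeg hι hκ hγ

end Summit.BirchSwinnertonDyer.BirchSwinnertonDyer.Theorems.BDPFramePrintMultiplicative

end
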